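import Mathlib.LinearAlgebra.Finsupp.LinearCombination
import Mathlib.Data.Rat.Cast.CharZero
import Mathlib.Data.List.Sort
import HarnessLib

/-!
# Sparse rational vectors as lists, their `Finsupp` meaning, and column operators (compute bridge)

Topic `Computation/Sparse` (compute infrastructure in the sense of `Literature/Computation/README`:
sorry-free, fact-free, soundness proved once).  A SPARSE VECTOR is a list `s : List (ℕ × ℚ)` of
(index, coefficient) pairs — duplicates and zeros allowed; its MEANING over a field `K` of
characteristic `0` is the finitely supported function `s.toF K = Σ_{(i,c) ∈ s} c • δ_i : ℕ →₀ K`.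
A COLUMN OPERATOR is given by a column generator `col : ℕ → SpVec`; its meaning is the `K`-linear map
`colOp K col = Finsupp.linearCombination K (fun i ↦ (col i).toF K) : (ℕ →₀ K) →ₗ[K] (ℕ →₀ K)`
(`δ_i ↦ col i`), and its EVALUATION on a sparse vector is the list computation
`s.applyCols col = s.flatMap (fun (i,c) ↦ (col i).map (fun (j,a) ↦ (j, c*a)))`.

Proved here (the whole trust interface between list computations run by `decide`/`native_decide`
and linear algebra in Mathlib vocabulary):
* `toF_nil/cons/append`, `toF_scale`, **`toF_applyCols`** : `(s.applyCols col).toF K = colOp K col (s.toF K)`;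
* `toF_normalize` : sorting, combining equal indices and dropping zeros does not change the meaning;
  `toF_eq_zero_of_normalize_eq_nil`, `toF_eq_of_sub` — how a checker's `normalize (a - b) = []`
  verdict becomes the equation `a.toF K = b.toF K`;
* `toF_mem_span` bookkeeping: `Finsupp.single i 1 = [(i,1)].toF`.

Everything is generic in the column generator; the columns themselves may be produced by any
program (they are DATA defining the operator).  Used by the Kummer-type orbifold-model certificates
(`AlgebraicGeometry/Hyperkaehler/KummerOrbifoldModel*`).

Sources: the coordinate ("COO") storage of sparse vectors/matrices with duplicate entries summed —
Y. Saad, *Iterative Methods for Sparse Linear Systems* (2nd ed., SIAM 2003), §3.4; the column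
interpretation of the matrix–vector product `Ax = Σ_j x_j a_j` ("gaxpy", column version) —
G. Golub, C. Van Loan, *Matrix Computations* (4th ed., 2013), §1.1.8.
-/

namespace Literature.Computation.Sparse

/-- A sparse rational vector: a list of (index, coefficient) pairs; duplicates and zero
coefficients are allowed (the meaning sums them). [folklore] -/
abbrev SpVec := List (ℕ × ℚ)

namespace SpVec

variable (K : Type*) [Field K] [CharZero K]

/-- The meaning of a sparse vector over `K`: `Σ_{(i,c) ∈ s} c • δ_i`. [folklore] -/
noncomputable def toF (s : SpVec) : ℕ →₀ K :=
  (s.map fun p ↦ Finsupp.single p.1 (p.2 : K)).sum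

omit [CharZero K] in
/-- Meaning of the empty list. [cite: Saad2003, §3.4 (coordinate storage format: duplicate entries are summed)] -/
@[simp] theorem toF_nil : toF K ([] : SpVec) = 0 := by simp [toF]

omit [CharZero K] in
/-- Meaning of a cons. [cite: Saad2003, §3.4 (coordinate storage format: duplicate entries are summed)] -/
@[simp] theorem toF_cons (p : ℕ × ℚ) (s : SpVec) :
    toF K (p :: s) = Finsupp.single p.1 (p.2 : K) + toF K s := by
  simp [toF]

omit [CharZero K] in
/-- Meaning of an append. [cite: Saad2003, §3.4 (coordinate storage format: duplicate entries are summed)] -/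
@[simp] theorem toF_append (s t : SpVec) : toF K (s ++ t) = toF K s + toF K t := by
  simp [toF, List.sum_append]

/-- Scaling all coefficients. [folklore] -/
def scale (c : ℚ) (s : SpVec) : SpVec := s.map fun p ↦ (p.1, c * p.2)

/-- Meaning of scaling. [cite: Saad2003, §3.4 (coordinate storage format: duplicate entries are summed)] -/
@[simp] theorem toF_scale (c : ℚ) (s : SpVec) : toF K (scale c s) = (c : K) • toF K s := by
  induction s with
  | nil => simp [scale, toF]
  | cons p t ih =>
    simp only [scale, List.map_cons] at ih ⊢
    rw [toF_cons, toF_cons, smul_add, ← ih, Rat.cast_mul, ← smul_eq_mul, Finsupp.smul_single]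
    rfl

/-- Negation and difference (for residual checks). [folklore] -/
def sub (s t : SpVec) : SpVec := s ++ scale (-1) t

/-- Meaning of the difference. [cite: Saad2003, §3.4 (coordinate storage format: duplicate entries are summed)] -/
@[simp] theorem toF_sub (s t : SpVec) : toF K (sub s t) = toF K s - toF K t := by
  simp [sub, sub_eq_add_neg]

/-! ### Column operators -/

/-- Evaluate the column operator with columns `col` on a sparse vector:
`Σ_{(i,c) ∈ s} c • col i`, as a list. [folklore] -/
def applyCols (col : ℕ → SpVec) (s : SpVec) : SpVec :=
  s.flatMap fun p ↦ scale p.2 (col p.1)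

/-- The `K`-linear map `δ_i ↦ (col i)` on `ℕ →₀ K` (Mathlib's `Finsupp.linearCombination`).
[folklore] -/
noncomputable def colOp (col : ℕ → SpVec) : (ℕ →₀ K) →ₗ[K] (ℕ →₀ K) :=
  Finsupp.linearCombination K fun i ↦ toF K (col i)

omit [CharZero K] in
/-- The column operator on a basis vector. [cite: GolubVanLoan2013, §1.1.8 (column-oriented gaxpy: Ax as a linear combination of columns)] -/
@[simp] theorem colOp_single (col : ℕ → SpVec) (i : ℕ) (c : K) :
    colOp K col (Finsupp.single i c) = c • toF K (col i) := by
  simp [colOp, Finsupp.linearCombination_single]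

/-- **The bridge**: the list evaluation means the linear map (`Ax = Σ_j x_j a_j`). [cite: GolubVanLoan2013, §1.1.8 (column-oriented gaxpy: Ax as a linear combination of columns)] -/
theorem toF_applyCols (col : ℕ → SpVec) (s : SpVec) :
    toF K (applyCols col s) = colOp K col (toF K s) := by
  induction s with
  | nil => simp [applyCols]
  | cons p t ih =>
    simp only [applyCols, List.flatMap_cons] at ih ⊢
    rw [toF_append, toF_scale, ih, toF_cons, map_add, colOp_single]

/-! ### Normal form -/

/-- Combine ADJACENT entries with equal index. [folklore] -/
def combine : SpVec → SpVec
  | [] => []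
  | [p] => [p]
  | p :: q :: t => if p.1 = q.1 then combine ((p.1, p.2 + q.2) :: t) else p :: combine (q :: t)
  termination_by s => s.length

/-- Combining adjacent equal indices does not change the meaning. [cite: Saad2003, §3.4 (coordinate storage format: duplicate entries are summed)] -/
theorem toF_combine (s : SpVec) : toF K (combine s) = toF K s := by
  induction s using combine.induct with
  | case1 => simp [combine]
  | case2 p => simp [combine]
  | case3 p q t h ih =>
    rw [combine, if_pos h, ih, toF_cons, toF_cons, toF_cons, ← add_assoc, h, Rat.cast_add,
      Finsupp.single_add]
  | case4 p q t h ih =>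
    rw [combine, if_neg h, toF_cons, ih, ← toF_cons]

/-- Drop zero coefficients. [folklore] -/
def dropZeros (s : SpVec) : SpVec := s.filter fun p ↦ p.2 ≠ 0

omit [CharZero K] in
/-- Dropping zeros does not change the meaning. [cite: Saad2003, §3.4 (coordinate storage format: duplicate entries are summed)] -/
theorem toF_dropZeros (s : SpVec) : toF K (dropZeros s) = toF K s := by
  induction s with
  | nil => simp [dropZeros]
  | cons p t ih =>
    by_cases hp : p.2 = 0
    · have : dropZeros (p :: t) = dropZeros t := by simp [dropZeros, hp]
      rw [this, ih, toF_cons, hp, Rat.cast_zero, Finsupp.single_zero, zero_add]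
    · have : dropZeros (p :: t) = p :: dropZeros t := by simp [dropZeros, hp]
      rw [this, toF_cons, toF_cons, ih]

omit [CharZero K] in
/-- The meaning is invariant under permutations of the list. [cite: Saad2003, §3.4 (coordinate storage format: duplicate entries are summed)] -/
theorem toF_perm {s t : SpVec} (h : s.Perm t) : toF K s = toF K t := by
  unfold toF
  exact (h.map _).sum_eq

/-- Normal form: sort by index, combine equal indices, drop zeros. [folklore] -/
def normalize (s : SpVec) : SpVec :=
  dropZeros (combine (s.mergeSort fun p q ↦ p.1 ≤ q.1))

/-- Normalising does not change the meaning. [cite: Saad2003, §3.4 (coordinate storage format: duplicate entries are summed)] -/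
theorem toF_normalize (s : SpVec) : toF K (normalize s) = toF K s := by
  rw [normalize, toF_dropZeros, toF_combine]
  exact toF_perm K (List.mergeSort_perm _ _)

/-- A checker's verdict `normalize s = []` means `s = 0`. [cite: Saad2003, §3.4 (coordinate storage format: duplicate entries are summed)] -/
theorem toF_eq_zero_of_normalize_eq_nil {s : SpVec} (h : normalize s = []) : toF K s = 0 := by
  rw [← toF_normalize K s, h, toF_nil]

/-- A checker's verdict `normalize (a - b) = []` means `a = b`. [cite: Saad2003, §3.4 (coordinate storage format: duplicate entries are summed)] -/
theorem toF_eq_of_normalize_sub {a b : SpVec} (h : normalize (sub a b) = []) : toF K a = toF K b := by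
  have := toF_eq_zero_of_normalize_eq_nil K h
  rwa [toF_sub, sub_eq_zero] at this

omit [CharZero K] in
/-- The basis vector `δ_i`. [cite: Saad2003, §3.4 (coordinate storage format: duplicate entries are summed)] -/
@[simp] theorem toF_single (i : ℕ) : toF K [(i, 1)] = Finsupp.single i 1 := by
  simp [toF]

end SpVec

end Literature.Computation.Sparse
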